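import Mathlib
import Summits.AnomalousDissipation.AnomalousDissipation.Theorems.MarginalStabilityChainStretchedVortexRowsStubRowVorticityConstructionToolsStrip
import Summits.AnomalousDissipation.AnomalousDissipation.Theorems.MarginalStabilityChainBurgersLayerLowReGreen

/-!
# Stub `stub_rowVorticityConstruction` (crux stmt-AnomalousDissipation-3009) — tools V(a):
# the shear far field of the cylinder Biot–Savart velocity, I — absolutely integrable kernels

Helper file (supports stmt-AnomalousDissipation-3009). For `L > 0`, a continuous `L`-periodic plane field
`ω` with a Gaussian bound `|ω(x,y)| ≤ C e^{−a y²}`, and the kernel-first cylinder Biot–Savart velocity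
`u(x,y) = −(2L)⁻¹ ∫_{S_L} K₁(q) ω(x − q₁, y − q₂) dq`, `v(x,y) = (2L)⁻¹ ∫_{S_L} K₂(q) ω(x − q₁, y − q₂) dq`
(`S_L = (−L/2, L/2] × ℝ`, `K₁ = sinh/(cosh − cos)`, `K₂ = sin/(cosh − cos)` at `(2πq₁/L, 2πq₂/L)`):

  `u(x, y) → ∓ M/(2L)` as `y → ±∞`,  `v(x, y) → 0` as `y → ±∞`,  `M = ∫_{S_L} ω` (the cell circulation),

for every `x` — the SHEAR FAR FIELD clause of `stub_rowVorticityConstruction` (`M = −L` gives `u → ±1/2`; this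
is where the far-field normalisation of the crux pins the circulation per period). Mechanism
(`tendsto_rowConvU_atTop/atBot`, `tendsto_rowConvV`): the algebraic identity
`K₁ − tanh t = K₁ · cos s / cosh t` (`t = 2πq₂/L`, `s = 2πq₁/L`) splits `K₁ = tanh + R` with `R` and `K₂`
ABSOLUTELY INTEGRABLE on the strip (`|R|, |K₂| ≤ (A + B/‖q‖) e^{−2π|q₂|/L}`), so `∫ R ω(x−q₁, y−q₂) → 0` and
`∫ K₂ ω(x−q₁,y−q₂) → 0` by dominated convergence (`ω(·, y − q₂) → 0`), while
`∫ tanh(2πq₂/L) ω(x − q₁, y − q₂) dq = ∫ tanh(2π(y − q₂)/L) ω(x − q₁, q₂) dq → ± ∫ ω(x − q₁, q₂) dq = ± M`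
(reflection/translation invariance in `q₂`, dominated convergence, and `x`-periodicity of the cell integral).
THIS FILE: the profile `tanh = sinh/cosh` and the remainder identity, absolute integrability on the strip from an
exponential bound (`integrable_strip_of_le_exp`, `integrable_rowKerU_sub_tanh`, `integrable_rowKerV`), the
dominated-convergence lemma `tendsto_rowConv_zero_of_integrable`, and `v → 0` (`tendsto_rowConvV`). The `u`-limits
are in tools V(b) (`…ToolsFarU`). Registered sub-goal proved here: `stub_rowVorticityConstruction_biotSavartCrossFar`.
All `[folklore]`.
-/

set_option linter.dupNamespace false

noncomputable section

open Real Set Filter Topology MeasureTheory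

namespace Summit.AnomalousDissipation.AnomalousDissipation.Theorems.MarginalStabilityChainStretchedVortexRows.RowBiotSavart

/-! ### The profile `tanh = sinh/cosh` and the remainder kernel -/

/-- `1/cosh t ≤ 2 e^{−|t|}`. [folklore] -/
theorem inv_cosh_le (t : ℝ) : (Real.cosh t)⁻¹ ≤ 2 * Real.exp (-|t|) := by
  have hc : Real.exp |t| / 2 ≤ Real.cosh t := by
    rw [← Real.cosh_abs, Real.cosh_eq]; linarith [Real.exp_pos (-|t|)]
  have hpos : 0 < Real.exp |t| / 2 := by positivity
  calc (Real.cosh t)⁻¹ ≤ (Real.exp |t| / 2)⁻¹ := inv_anti₀ hpos hc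
    _ = 2 * Real.exp (-|t|) := by rw [Real.exp_neg]; field_simp

/-- The remainder identity `k₁ − tanh = k₁ · cos s / cosh t` (valid everywhere, both sides being `0` on the
zero set of the denominator). [folklore] -/
theorem kerU_sub_tanh (s t : ℝ) :
    Real.sinh t / (Real.cosh t - Real.cos s) - Real.sinh t / Real.cosh t =
      Real.sinh t / (Real.cosh t - Real.cos s) * (Real.cos s / Real.cosh t) := by
  have hc : Real.cosh t ≠ 0 := (Real.cosh_pos t).ne'
  by_cases hD : Real.cosh t - Real.cos s = 0
  · have ht : Real.cosh t = 1 := le_antisymm (by linarith [Real.cos_le_one s]) (Real.one_le_cosh t)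
    have ht0 : t = 0 := by
      by_contra h
      have := Real.one_lt_cosh.2 h
      linarith
    simp [ht0]
  · field_simp
    ring

/-- `tanh = sinh/cosh → 1` at `+∞`. [folklore] -/
theorem tendsto_sinh_div_cosh_atTop : Tendsto (fun t => Real.sinh t / Real.cosh t) atTop (𝓝 1) := by
  have h : ∀ t, Real.sinh t / Real.cosh t = 1 - Real.exp (-t) / Real.cosh t := fun t => by
    rw [eq_sub_iff_add_eq, ← add_div, div_eq_one_iff_eq (Real.cosh_pos t).ne', Real.sinh_eq, Real.cosh_eq]
    ring
  have h0 : Tendsto (fun t => Real.exp (-t) / Real.cosh t) atTop (𝓝 0) := by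
    refine squeeze_zero (fun t => by positivity) (fun t => ?_) Real.tendsto_exp_neg_atTop_nhds_zero
    exact div_le_self (Real.exp_pos _).le (Real.one_le_cosh t)
  have h1 := (tendsto_const_nhds (x := (1 : ℝ)) (f := (atTop : Filter ℝ))).sub h0
  rw [sub_zero] at h1
  exact h1.congr fun t => (h t).symm

/-- `tanh = sinh/cosh → −1` at `−∞`. [folklore] -/
theorem tendsto_sinh_div_cosh_atBot : Tendsto (fun t => Real.sinh t / Real.cosh t) atBot (𝓝 (-1)) := by
  have h := (tendsto_sinh_div_cosh_atTop.comp tendsto_neg_atBot_atTop).neg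
  refine h.congr fun t => ?_
  simp [Real.sinh_neg, Real.cosh_neg, neg_div]

/-! ### Absolute integrability on the strip from an exponential bound -/

/-- A measurable `f` with `|f(q)| ≤ (A + D/‖q‖) e^{−c|q₂|}` on the strip (`c > 0`, `D ≥ 0`) is integrable on the
strip. [folklore] -/
theorem integrable_strip_of_le_exp {L : ℝ} {f : ℝ × ℝ → ℝ} (hf : Measurable f) {A D c : ℝ}
    (hD : 0 ≤ D) (hc : 0 < c)
    (hle : ∀ q ∈ Ioc (-(L / 2)) (L / 2) ×ˢ (univ : Set ℝ), |f q| ≤ (A + D / ‖q‖) * Real.exp (-c * |q.2|)) :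
    Integrable f ((volume : Measure (ℝ × ℝ)).restrict (Ioc (-(L / 2)) (L / 2) ×ˢ (univ : Set ℝ))) := by
  set S : Set (ℝ × ℝ) := Ioc (-(L / 2)) (L / 2) ×ˢ (univ : Set ℝ)
  have he : Integrable (fun t : ℝ => Real.exp (-c * |t|)) := by
    have := MarginalStabilityChainBurgersLayerLowRe.integrable_kernel hc 0
    refine this.congr (Eventually.of_forall fun t => ?_)
    simp only [zero_sub, abs_neg]; ring_nf
  have h1 : Integrable (fun q : ℝ × ℝ => (A + D) * Real.exp (-c * |q.2|)) (volume.restrict S) :=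
    integrable_strip_of_snd L (he.const_mul _)
  have h2 : Integrable (fun q : ℝ × ℝ => (Metric.ball (0 : ℝ × ℝ) 1).indicator (fun q => ‖q‖⁻¹) q)
      (volume.restrict S) :=
    ((integrableOn_inv_norm_ball 1).integrable_indicator measurableSet_ball).mono_measure
      Measure.restrict_le_self
  refine Integrable.mono' (h1.add (h2.const_mul D)) hf.aestronglyMeasurable ?_
  rw [ae_restrict_iff' (measurableSet_Ioc.prod MeasurableSet.univ)]
  refine Eventually.of_forall fun q hq => ?_
  have hfq := hle q hq
  have he0 : 0 < Real.exp (-c * |q.2|) := Real.exp_pos _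
  have he1 : Real.exp (-c * |q.2|) ≤ 1 := by
    rw [Real.exp_le_one_iff]; nlinarith [abs_nonneg q.2]
  have hind : 0 ≤ (Metric.ball (0 : ℝ × ℝ) 1).indicator (fun q : ℝ × ℝ => ‖q‖⁻¹) q :=
    indicator_nonneg (fun q _ => inv_nonneg.2 (norm_nonneg q)) q
  have hD' : D / ‖q‖ ≤ D + D * (Metric.ball (0 : ℝ × ℝ) 1).indicator (fun q => ‖q‖⁻¹) q := by
    by_cases hq1 : q ∈ Metric.ball (0 : ℝ × ℝ) 1
    · rw [indicator_of_mem hq1, div_eq_mul_inv]; linarith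
    · rw [indicator_of_notMem hq1, mul_zero, add_zero]
      rw [Metric.mem_ball, dist_zero_right, not_lt] at hq1
      exact div_le_self hD hq1
  rw [Real.norm_eq_abs]
  calc |f q| ≤ (A + D / ‖q‖) * Real.exp (-c * |q.2|) := hfq
    _ ≤ (A + D + D * (Metric.ball (0 : ℝ × ℝ) 1).indicator (fun q => ‖q‖⁻¹) q) * Real.exp (-c * |q.2|) :=
        mul_le_mul_of_nonneg_right (by linarith) he0.le
    _ = (A + D) * Real.exp (-c * |q.2|) +
          D * (Metric.ball (0 : ℝ × ℝ) 1).indicator (fun q => ‖q‖⁻¹) q * Real.exp (-c * |q.2|) := by ring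
    _ ≤ (A + D) * Real.exp (-c * |q.2|) + D * (Metric.ball (0 : ℝ × ℝ) 1).indicator (fun q => ‖q‖⁻¹) q := by
        have : D * (Metric.ball (0 : ℝ × ℝ) 1).indicator (fun q : ℝ × ℝ => ‖q‖⁻¹) q * Real.exp (-c * |q.2|) ≤
            D * (Metric.ball (0 : ℝ × ℝ) 1).indicator (fun q => ‖q‖⁻¹) q * 1 :=
          mul_le_mul_of_nonneg_left he1 (mul_nonneg hD hind)
        linarith

/-- The REMAINDER KERNEL `R = K₁ − tanh(2πq₂/L)` is absolutely integrable on the strip. [folklore] -/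
theorem integrable_rowKerU_sub_tanh {L : ℝ} (hL : 0 < L) :
    Integrable (fun q : ℝ × ℝ =>
      Real.sinh (2 * π * q.2 / L) / (Real.cosh (2 * π * q.2 / L) - Real.cos (2 * π * q.1 / L)) -
        Real.sinh (2 * π * q.2 / L) / Real.cosh (2 * π * q.2 / L))
      ((volume : Measure (ℝ × ℝ)).restrict (Ioc (-(L / 2)) (L / 2) ×ˢ (univ : Set ℝ))) := by
  refine integrable_strip_of_le_exp (by fun_prop) (A := 4) (D := 20 * L / π) (c := 2 * π / L)
    (by positivity) (by positivity) fun q hq => ?_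
  rw [kerU_sub_tanh, abs_mul]
  have h1 := abs_rowKerU_le hL hq
  have h2 : |Real.cos (2 * π * q.1 / L) / Real.cosh (2 * π * q.2 / L)| ≤ 2 * Real.exp (-(2 * π / L) * |q.2|) := by
    rw [abs_div, abs_of_pos (Real.cosh_pos _)]
    have hc := inv_cosh_le (2 * π * q.2 / L)
    have habs : |2 * π * q.2 / L| = 2 * π / L * |q.2| := by
      rw [abs_div, abs_mul, abs_of_pos hL, abs_of_pos (by positivity : (0:ℝ) < 2 * π)]; ring
    rw [habs] at hc
    calc |Real.cos (2 * π * q.1 / L)| / Real.cosh (2 * π * q.2 / L)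
        ≤ 1 / Real.cosh (2 * π * q.2 / L) :=
          div_le_div_of_nonneg_right (Real.abs_cos_le_one _) (Real.cosh_pos _).le
      _ ≤ 2 * Real.exp (-(2 * π / L) * |q.2|) := by rw [one_div, neg_mul]; exact hc
  have h0 : 0 ≤ |Real.sinh (2 * π * q.2 / L) / (Real.cosh (2 * π * q.2 / L) - Real.cos (2 * π * q.1 / L))| :=
    abs_nonneg _
  calc _ ≤ (2 + 10 * L / π / ‖q‖) * (2 * Real.exp (-(2 * π / L) * |q.2|)) :=
        mul_le_mul h1 h2 (abs_nonneg _) (by positivity)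
    _ = (4 + 20 * L / π / ‖q‖) * Real.exp (-(2 * π / L) * |q.2|) := by ring

/-- The kernel `K₂` is absolutely integrable on the strip. [folklore] -/
theorem integrable_rowKerV {L : ℝ} (hL : 0 < L) :
    Integrable (fun q : ℝ × ℝ =>
      Real.sin (2 * π * q.1 / L) / (Real.cosh (2 * π * q.2 / L) - Real.cos (2 * π * q.1 / L)))
      ((volume : Measure (ℝ × ℝ)).restrict (Ioc (-(L / 2)) (L / 2) ×ˢ (univ : Set ℝ))) := by
  refine integrable_strip_of_le_exp (measurable_rowKerV L) (A := 16) (D := 80 * L / π) (c := 2 * π / L)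
    (by positivity) (by positivity) fun q hq => ?_
  have habs : |2 * π * q.2 / L| = 2 * π / L * |q.2| := by
    rw [abs_div, abs_mul, abs_of_pos hL, abs_of_pos (by positivity : (0:ℝ) < 2 * π)]; ring
  have h1 := abs_rowKerV_le hL hq
  have hn : 0 ≤ 80 * L / π / ‖q‖ := by positivity
  rcases le_or_gt 2 |2 * π * q.2 / L| with ht | ht
  · have h2 := abs_kerV_le_exp (s := 2 * π * q.1 / L) ht
    rw [habs] at h2
    have he : 0 < Real.exp (-(2 * π / L * |q.2|)) := Real.exp_pos _
    calc _ ≤ 3 * Real.exp (-(2 * π / L * |q.2|)) := h2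
      _ ≤ (16 + 80 * L / π / ‖q‖) * Real.exp (-(2 * π / L) * |q.2|) := by
          rw [neg_mul]; nlinarith [mul_nonneg hn he.le]
  · -- near the axis `e^{2π|q₂|/L} ≤ e² ≤ 8`
    have he : 1 ≤ 8 * Real.exp (-(2 * π / L) * |q.2|) := by
      rw [neg_mul, ← habs, Real.exp_neg]
      have h8 : Real.exp |2 * π * q.2 / L| ≤ 8 := by
        have := Real.exp_le_exp.2 ht.le
        have h2 : Real.exp 2 ≤ 8 := by
          rw [show (2:ℝ) = 1 + 1 by norm_num, Real.exp_add]; nlinarith [Real.exp_one_lt_d9, Real.exp_pos 1]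
        linarith
      have hp : 0 < Real.exp |2 * π * q.2 / L| := Real.exp_pos _
      rw [le_mul_inv_iff₀ hp]; linarith
    calc _ ≤ 2 + 10 * L / π / ‖q‖ := h1
      _ ≤ (2 + 10 * L / π / ‖q‖) * (8 * Real.exp (-(2 * π / L) * |q.2|)) := le_mul_of_one_le_right (by positivity) he
      _ = (16 + 80 * L / π / ‖q‖) * Real.exp (-(2 * π / L) * |q.2|) := by ring

/-! ### Dominated convergence for absolutely integrable kernels -/

section Limits

variable {L : ℝ} {ω : ℝ → ℝ → ℝ} {C a : ℝ}

/-- A Gaussian-bounded field tends to `0` along any filter on which `(y − t)² → ∞` for every `t`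
(`atTop`, `atBot`). [folklore] -/
theorem tendsto_field_of_gaussBound (hb : ∀ x y, |ω x y| ≤ C * Real.exp (-a * y ^ 2)) (ha : 0 < a)
    {l : Filter ℝ} (hl : ∀ t : ℝ, Tendsto (fun y => (y - t) ^ 2) l atTop) (x t : ℝ) :
    Tendsto (fun y => ω x (y - t)) l (𝓝 0) := by
  have h1 : Tendsto (fun y => C * Real.exp (-a * (y - t) ^ 2)) l (𝓝 0) := by
    rw [show (0:ℝ) = C * 0 by simp]
    refine tendsto_const_nhds.mul ?_
    have : Tendsto (fun y => a * (y - t) ^ 2) l atTop := (hl t).const_mul_atTop ha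
    have h2 := Real.tendsto_exp_neg_atTop_nhds_zero.comp this
    refine h2.congr fun y => ?_
    simp only [Function.comp_apply]; ring_nf
  refine squeeze_zero_norm (fun y => ?_) h1
  rw [Real.norm_eq_abs]; exact hb x (y - t)

/-- `(y − t)² → ∞` as `y → +∞`. [folklore] -/
theorem tendsto_sub_sq_atTop (t : ℝ) : Tendsto (fun y : ℝ => (y - t) ^ 2) atTop atTop :=
  (tendsto_pow_atTop two_ne_zero).comp (tendsto_atTop_add_const_right _ (-t) tendsto_id)

/-- `(y − t)² → ∞` as `y → −∞`. [folklore] -/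
theorem tendsto_sub_sq_atBot (t : ℝ) : Tendsto (fun y : ℝ => (y - t) ^ 2) atBot atTop := by
  have h : Tendsto (fun y : ℝ => (t - y) ^ 2) atBot atTop :=
    (tendsto_pow_atTop two_ne_zero).comp (tendsto_atTop_add_const_left _ t tendsto_neg_atBot_atTop)
  refine h.congr fun y => ?_
  ring

/-- **Absolutely integrable kernels see nothing at `y → ±∞`**: for `k ∈ L¹(S_L)` and a continuous
Gaussian-bounded `ω`, `∫_{S_L} k(q) ω(x − q₁, y − q₂) dq → 0` along `atTop`/`atBot`. [folklore] -/
theorem tendsto_rowConv_zero_of_integrable {k : ℝ × ℝ → ℝ}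
    (hk : Integrable k ((volume : Measure (ℝ × ℝ)).restrict (Ioc (-(L / 2)) (L / 2) ×ˢ (univ : Set ℝ))))
    (hω : Continuous fun p : ℝ × ℝ => ω p.1 p.2) (hb : ∀ x y, |ω x y| ≤ C * Real.exp (-a * y ^ 2))
    (ha : 0 < a) {l : Filter ℝ} [l.IsCountablyGenerated] (hl : ∀ t : ℝ, Tendsto (fun y => (y - t) ^ 2) l atTop)
    (x : ℝ) :
    Tendsto (fun y => ∫ q in Ioc (-(L / 2)) (L / 2) ×ˢ (univ : Set ℝ), k q * ω (x - q.1) (y - q.2)) l (𝓝 0) := by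
  have hC : 0 ≤ C := by
    have := hb 0 0; simp at this; exact (abs_nonneg _).trans this
  have hωb : ∀ x y, |ω x y| ≤ C := fun x y => (hb x y).trans (by
    have : Real.exp (-a * y ^ 2) ≤ 1 := by rw [Real.exp_le_one_iff]; nlinarith [sq_nonneg y]
    nlinarith)
  rw [show (0:ℝ) = ∫ q in Ioc (-(L / 2)) (L / 2) ×ˢ (univ : Set ℝ), k q * (0:ℝ) by simp]
  refine tendsto_integral_filter_of_dominated_convergence (fun q => ‖k q‖ * C) ?_ ?_ (hk.norm.mul_const C) ?_
  · refine Eventually.of_forall fun y => hk.aestronglyMeasurable.mul ?_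
    have : Continuous fun q : ℝ × ℝ => ω (x - q.1) (y - q.2) :=
      hω.comp ((continuous_const.sub continuous_fst).prodMk (continuous_const.sub continuous_snd))
    exact this.aestronglyMeasurable
  · refine Eventually.of_forall fun y => Eventually.of_forall fun q => ?_
    rw [norm_mul]
    exact mul_le_mul_of_nonneg_left (by rw [Real.norm_eq_abs]; exact hωb _ _) (norm_nonneg _)
  · refine Eventually.of_forall fun q => (tendsto_field_of_gaussBound hb ha hl (x - q.1) q.2).const_mul _

/-- **The cross velocity vanishes at `y → ±∞`**: `∫_{S_L} K₂(q) ω(x − q₁, y − q₂) dq → 0` along `atTop` and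
`atBot` (so `v = (2L)⁻¹ ∫ K₂ ω → 0`). [folklore] -/
theorem tendsto_rowConvV (hL : 0 < L) (hω : Continuous fun p : ℝ × ℝ => ω p.1 p.2)
    (hb : ∀ x y, |ω x y| ≤ C * Real.exp (-a * y ^ 2)) (ha : 0 < a) {l : Filter ℝ} [l.IsCountablyGenerated]
    (hl : ∀ t : ℝ, Tendsto (fun y => (y - t) ^ 2) l atTop) (x : ℝ) :
    Tendsto (fun y => ∫ q in Ioc (-(L / 2)) (L / 2) ×ˢ (univ : Set ℝ),
      Real.sin (2 * π * q.1 / L) / (Real.cosh (2 * π * q.2 / L) - Real.cos (2 * π * q.1 / L)) *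
        ω (x - q.1) (y - q.2)) l (𝓝 0) :=
  tendsto_rowConv_zero_of_integrable (integrable_rowKerV hL) hω hb ha hl x

end Limits

end RowBiotSavart

open RowBiotSavart in
/-- **The cross velocity of the cylinder Biot–Savart law vanishes at `y → ±∞`** (registered on
stmt-AnomalousDissipation-3009 as the helper stub `stub_rowVorticityConstruction_biotSavartCrossFar` of
`stub_rowVorticityConstruction`): for `L > 0` and a continuous plane field `ω` with `|ω(x, y)| ≤ C e^{−a y²}`
(`a > 0`), `v(x, y) = (2L)⁻¹ ∫_{S_L} K₂(q) ω(x − q₁, y − q₂) dq → 0` as `y → +∞` and as `y → −∞`, for every `x`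
(`RowBiotSavart.tendsto_rowConvV`: `K₂ ∈ L¹(S_L)` and dominated convergence). [folklore] -/
theorem stub_rowVorticityConstruction_biotSavartCrossFar :
    ∀ (L : ℝ) (ω : ℝ → ℝ → ℝ) (C a : ℝ), 0 < L → 0 < a → Continuous (fun p : ℝ × ℝ => ω p.1 p.2) →
      (∀ x y, |ω x y| ≤ C * Real.exp (-a * y ^ 2)) →
      ∀ x : ℝ,
        Filter.Tendsto (fun y => 1 / (2 * L) * ∫ q in Set.Ioc (-(L / 2)) (L / 2) ×ˢ (Set.univ : Set ℝ),
            Real.sin (2 * Real.pi * q.1 / L) / (Real.cosh (2 * Real.pi * q.2 / L) - Real.cos (2 * Real.pi * q.1 / L)) *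
              ω (x - q.1) (y - q.2)) Filter.atTop (nhds 0) ∧
        Filter.Tendsto (fun y => 1 / (2 * L) * ∫ q in Set.Ioc (-(L / 2)) (L / 2) ×ˢ (Set.univ : Set ℝ),
            Real.sin (2 * Real.pi * q.1 / L) / (Real.cosh (2 * Real.pi * q.2 / L) - Real.cos (2 * Real.pi * q.1 / L)) *
              ω (x - q.1) (y - q.2)) Filter.atBot (nhds 0) :=
  fun L _ _ _ hL ha hω hb x =>
    ⟨by simpa using (tendsto_rowConvV hL hω hb ha tendsto_sub_sq_atTop x).const_mul (1 / (2 * L)),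
     by simpa using (tendsto_rowConvV hL hω hb ha tendsto_sub_sq_atBot x).const_mul (1 / (2 * L))⟩

end Summit.AnomalousDissipation.AnomalousDissipation.Theorems.MarginalStabilityChainStretchedVortexRows

end
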